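import Summits.HodgeConjecture.CorCM.Census.DecicWeil23Pair
import Mathlib.GroupTheory.Perm.Basic
import HarnessLib

/-!
# ANY NUMBER `r` of CM types over one OCTIC CM field `K ∋ k`: `E × B₁ × ⋯ × B_r` (CM FOURFOLDS of `k`-signature `(2,2)` or `(1,3)`)
# — the finite model of the balanced weights of every product of copies, the types read at ARBITRARY positions through an
# ARBITRARY permutation of the four conjugate pairs

COR-CM (cell `pub-hodgecm2`), seat b30 gen 24 (2026-08-22); count-neutral own lane OCTIC-MULTI (census half) = the slot-generic
successor of gens 18–21 (`Census/OcticCurveFourfold`, `Census/OcticWeilMixed`, `Census/OcticWeil13Pair`: one `(1,3)`-type; two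
`(2,2)` + one `(1,3)`; one `(2,2)` + two `(1,3)`), one degree below `Census/DecicWeil23Multi` (same text with four pairs): ONE
model for every number `r` of types, arbitrary position function `P : Fin r → Fin 4 → Bool` (`I_m = {a | P m a}` of weight `2` for
a `(2,2)`-type, weight `1` for a `(1,3)`-type) and an arbitrary set `R` of permutations of the four conjugate pairs.  Bookkeeping
definitions and theorems of a finite model; no named fact, no geometry, no `sorry`, no `decide`.

MODEL.  `PtO r = Bool ⊕ (Fin r × (Fin 4 × Bool))` (`inl b` = the embedding `τ_b` of `k`; `inr (m, (a, b))` = the embedding of `K`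
of sign `b` in the pair `a` on a factor of type `m`); `phiO P π = {inl true} ⊔ {inr (m, (a, b)) | b = P m (π a)}` = `π⁻¹(types)`;
`ModelBalancedO P R v T`: the equations `2 · #{x ∈ T | v x ∈ phiO P π} = |T|`, `π ∈ R`.
RESULTS (kernel).  `cjO`, membership, `phiO_eq`, `mem_phiO_iff_cjO_not_mem`, counting fibrewise, **the signed form**
`balancedO_iff_signed`.  THE DEFECT LAW (`d_{m,a} = t_m`, `e = Σ_m (4 − 2·#I_m)·t_m` from `2`-transitivity of `R` and INDEPENDENCE of
`𝟙, 𝟙_{I_1}, …, 𝟙_{I_r}` in `ℤ⁴`) is the sequel `Census/OcticWeilMultiDefect.lean`.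
[cite: Pohlmann1968, Thm 1] [cite: GaoUllmo2025, Thm 3.1] [cite: MoonenZarhin1995Duke, Thm. 2.4] [cite: Gordon1999HodgeAVSurvey, 5.13 (ii), 9.2.2]

## References
* [Pohlmann1968] H. Pohlmann, Ann. of Math. 88 (1968), Thm 1.  [GaoUllmo2025] Z. Gao, E. Ullmo, J. Inst. Math. Jussieu 25
  (2025), Thm 3.1.  [MoonenZarhin1995Duke] B. Moonen, Yu. Zarhin, Duke Math. J. 77 (1995), Thm. 2.4.  [Gordon1999HodgeAVSurvey]
  B. B. Gordon, CRM Monogr. 10 (1999), 5.13 (ii), 9.2.2.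

## Provenance
Exact python first (gens 19–21, `HOME/pub-hodgecm2-b30/octic-orbit/mixed_census*.py`, `octic-eightfold/census13pair.py`): clean
configurations = those with `𝟙, 𝟙_{I_m}` independent (ORBIT `3×(2,2)` star, MIXED `2×(2,2)+(1,3)`, EIGHTFOLD `(2,2)+2×(1,3)` split);
the failures (`3×(2,2)+(1,3)`, `2×(2,2)+2×(1,3)`, non-split `(2,2)+2×(1,3)`) are exactly the dependent ones.
-/

namespace Summit.HodgeConjecture.CorCM.Census.OcticWeilMulti

open Finset

variable {r : ℕ}

/-! ### The model -/

/-- Points: `inl b` = embedding of `k` of sign `b`; `inr (m, (a, b))` = embedding of `K` of sign `b` in the pair `a` on a factor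
of type `m < r`. [cite: GaoUllmo2025, §2.1] -/
abbrev PtO (r : ℕ) : Type := Bool ⊕ (Fin r × (Fin 4 × Bool))

/-- Complex conjugation on the model: the sign flips. [folklore] -/
def cjO : PtO r → PtO r
  | Sum.inl b => Sum.inl (!b)
  | Sum.inr (m, (a, b)) => Sum.inr (m, (a, !b))

/-- Unfolding of `cjO`, curve slot. [folklore] -/
theorem cjO_inl (b : Bool) : cjO (r := r) (Sum.inl b) = Sum.inl (!b) := rfl

/-- Unfolding of `cjO`, fourfold slots. [folklore] -/
theorem cjO_inr (m : Fin r) (a : Fin 4) (b : Bool) : cjO (Sum.inr (m, (a, b))) = Sum.inr (m, (a, !b)) := rfl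

/-- `cjO` is an involution. [folklore] -/
theorem cjO_cjO (y : PtO r) : cjO (cjO y) = y := by
  rcases y with b | ⟨m, a, b⟩
  · rw [cjO_inl, cjO_inl, Bool.not_not]
  · rw [cjO_inr, cjO_inr, Bool.not_not]

/-- `cjO` has no fixed point. [folklore] -/
theorem cjO_ne (y : PtO r) : cjO y ≠ y := by
  rcases y with b | ⟨m, a, b⟩
  · rw [cjO_inl]; cases b <;> simp
  · rw [cjO_inr]; cases b <;> simp

/-- **`π⁻¹(types)` read in the model** (Boolean form): the types sit at the positions `P m` (`I_m = {a | P m a}`) and are read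
through the permutation `π` of the pairs. [cite: GaoUllmo2025, Thm 3.1 (3.2)] -/
def inPhiO (P : Fin r → Fin 4 → Bool) (π : Fin 4 → Fin 4) : PtO r → Bool
  | Sum.inl b => b
  | Sum.inr (m, (a, b)) => b == P m (π a)

/-- `π⁻¹(types)` as a finset of the model. [cite: GaoUllmo2025, Thm 3.1 (3.2)] -/
def phiO (P : Fin r → Fin 4 → Bool) (π : Fin 4 → Fin 4) : Finset (PtO r) := univ.filter fun y => inPhiO P π y = true

variable (P : Fin r → Fin 4 → Bool) (π : Fin 4 → Fin 4)

/-- Membership, curve slot. [folklore] -/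
theorem inl_mem_phiO (b : Bool) : Sum.inl b ∈ phiO P π ↔ b = true := by
  simp [phiO, inPhiO]

/-- Membership, fourfold slots. [folklore] -/
theorem inr_mem_phiO (m : Fin r) (a : Fin 4) (b : Bool) : Sum.inr (m, (a, b)) ∈ phiO P π ↔ b = P m (π a) := by
  simp [phiO, inPhiO]

/-- Each `phiO P π` is a CM type of the model: it contains exactly one of `y`, `cjO y`. [folklore] -/
theorem mem_phiO_iff_cjO_not_mem (y : PtO r) : y ∈ phiO P π ↔ cjO y ∉ phiO P π := by
  rcases y with b | ⟨m, a, b⟩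
  · rw [cjO_inl, inl_mem_phiO, inl_mem_phiO]
    cases b <;> simp
  · rw [cjO_inr, inr_mem_phiO, inr_mem_phiO]
    cases b <;> cases P m (π a) <;> simp

/-- `phiO P π` as an explicit finset: `{inl true} ⊔ {inr (m, (a, P m (π a)))}`. [folklore] -/
theorem phiO_eq : phiO P π =
    insert (Sum.inl true) ((univ : Finset (Fin r × Fin 4)).image fun q => (Sum.inr (q.1, (q.2, P q.1 (π q.2))) : PtO r)) := by
  ext y
  rw [Finset.mem_insert, Finset.mem_image]
  rcases y with b | ⟨m, a, b⟩
  · rw [inl_mem_phiO]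
    constructor
    · rintro rfl
      exact Or.inl rfl
    · rintro (h | ⟨q, -, hq⟩)
      · exact Sum.inl_injective h
      · exact absurd hq Sum.inr_ne_inl
  · rw [inr_mem_phiO]
    constructor
    · rintro rfl
      exact Or.inr ⟨(m, a), Finset.mem_univ _, rfl⟩
    · rintro (h | ⟨⟨m', a'⟩, -, hq⟩)
      · exact absurd h Sum.inr_ne_inl
      · simp only [Sum.inr.injEq, Prod.mk.injEq] at hq
        obtain ⟨rfl, rfl, rfl⟩ := hq
        rfl

/-! ### Balanced configurations -/

variable {α : Type*}

/-- **Pohlmann's condition for a configuration** of a product of copies of `E, B₁, …, B_r` under a set `R` of realised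
permutations of the pairs: `2 · #{x ∈ T | v x ∈ π⁻¹(types)} = |T|` for `π ∈ R`. [cite: GaoUllmo2025, Thm 3.1 eq. (3.2)]
[cite: Pohlmann1968, Thm 1] -/
def ModelBalancedO (P : Fin r → Fin 4 → Bool) (R : Finset (Equiv.Perm (Fin 4))) (v : α → PtO r) (T : Finset α) : Prop :=
  ∀ π ∈ R, 2 * (T.filter fun x => v x ∈ phiO P π).card = T.card

variable (R : Finset (Equiv.Perm (Fin 4))) (v : α → PtO r)

/-- The empty configuration is balanced. [folklore] -/
theorem modelBalancedO_empty : ModelBalancedO P R v (∅ : Finset α) := fun _ _ => by simp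

variable {P R v}

/-- **Removing a balanced part keeps the balance.** [folklore] -/
theorem ModelBalancedO.sdiff [DecidableEq α] {T G : Finset α} (hT : ModelBalancedO P R v T) (hG : ModelBalancedO P R v G)
    (hGT : G ⊆ T) : ModelBalancedO P R v (T \ G) := by
  intro π hπ
  have key : ∀ (Q : α → Prop) [DecidablePred Q],
      ((T \ G).filter Q).card = (T.filter Q).card - (G.filter Q).card := by
    intro Q _
    rw [← Finset.card_sdiff_of_subset (Finset.filter_subset_filter Q hGT)]
    congr 1
    ext x
    simp only [Finset.mem_filter, Finset.mem_sdiff]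
    tauto
  have h1 := hT π hπ
  have h2 := hG π hπ
  have h3 := Finset.card_sdiff_of_subset hGT
  have h4 : (G.filter fun x => v x ∈ phiO P π).card ≤ (T.filter fun x => v x ∈ phiO P π).card :=
    Finset.card_le_card (Finset.filter_subset_filter _ hGT)
  rw [key, h3]
  omega

/-! ### Counting fibrewise; the signed form -/

variable (v)

/-- `#{x ∈ T | v x ∈ W} = Σ_{y ∈ W} #{x ∈ T | v x = y}`. [folklore] -/
theorem card_filter_mem_eq_sumO (T : Finset α) (W : Finset (PtO r)) :
    (T.filter fun x => v x ∈ W).card = ∑ y ∈ W, (T.filter fun x => v x = y).card := by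
  rw [Finset.card_eq_sum_card_fiberwise (f := v) (s := T.filter fun x => v x ∈ W) (t := W)
    (fun x hx => (Finset.mem_filter.1 (Finset.mem_coe.1 hx)).2)]
  refine Finset.sum_congr rfl fun y hy => ?_
  congr 1
  ext x
  simp only [Finset.mem_filter]
  constructor
  · rintro ⟨⟨hx, -⟩, hxy⟩; exact ⟨hx, hxy⟩
  · rintro ⟨hx, hxy⟩; exact ⟨⟨hx, hxy ▸ hy⟩, hxy⟩

/-- `|T| = Σ_y #{x ∈ T | v x = y}`. [folklore] -/
theorem card_eq_sumO (T : Finset α) : T.card = ∑ y : PtO r, (T.filter fun x => v x = y).card := by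
  rw [← card_filter_mem_eq_sumO v T univ]
  congr 1
  ext x
  simp

/-- A sum over the model, expanded by slots. [folklore] -/
theorem sum_ptO (N : PtO r → ℕ) : ∑ y : PtO r, N y =
    N (Sum.inl true) + N (Sum.inl false) + ∑ m : Fin r, ∑ a : Fin 4, (N (Sum.inr (m, (a, true))) + N (Sum.inr (m, (a, false)))) := by
  rw [Fintype.sum_sum_type, Fintype.sum_bool, Fintype.sum_prod_type]
  simp only [Fintype.sum_prod_type, Fintype.sum_bool]

variable (P)

/-- The sum over `phiO P π`, expanded. [folklore] -/
theorem sum_phiO (N : PtO r → ℕ) :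
    ∑ y ∈ phiO P π, N y = N (Sum.inl true) + ∑ m : Fin r, ∑ a : Fin 4, N (Sum.inr (m, (a, P m (π a)))) := by
  rw [phiO_eq P π]
  have hinj : Function.Injective fun q : Fin r × Fin 4 => (Sum.inr (q.1, (q.2, P q.1 (π q.2))) : PtO r) := by
    rintro ⟨m, a⟩ ⟨m', a'⟩ h
    simp only [Sum.inr.injEq, Prod.mk.injEq] at h
    obtain ⟨rfl, rfl, -⟩ := h
    rfl
  have h1 : Sum.inl true ∉ (univ : Finset (Fin r × Fin 4)).image
      fun q => (Sum.inr (q.1, (q.2, P q.1 (π q.2))) : PtO r) := by simp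
  rw [Finset.sum_insert h1, Finset.sum_image fun q _ q' _ h => hinj h, Fintype.sum_prod_type]

/-- **The signed form of the balance equation at `π`**: `2 Σ_{y ∈ phiO P π} N y = Σ_y N y` iff
`(N t − N f) + Σ_{m,a} ± (N(m,a,t) − N(m,a,f)) = 0`, the sign being `+` iff `P m (π a)`. [cite: GaoUllmo2025, Thm 3.1] -/
theorem balancedO_iff_signed (N : PtO r → ℕ) :
    2 * ∑ y ∈ phiO P π, N y = ∑ y : PtO r, N y ↔
      ((N (Sum.inl true) : ℤ) - N (Sum.inl false)) + ∑ m : Fin r, ∑ a : Fin 4,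
        (if P m (π a) then ((N (Sum.inr (m, (a, true))) : ℤ) - N (Sum.inr (m, (a, false))))
          else -(((N (Sum.inr (m, (a, true))) : ℤ) - N (Sum.inr (m, (a, false)))))) = 0 := by
  rw [sum_phiO, sum_ptO]
  have key : ∀ m a, (2 * (N (Sum.inr (m, (a, P m (π a)))) : ℤ)) =
      ((N (Sum.inr (m, (a, true))) : ℤ) + N (Sum.inr (m, (a, false)))) +
        (if P m (π a) then ((N (Sum.inr (m, (a, true))) : ℤ) - N (Sum.inr (m, (a, false))))
          else -(((N (Sum.inr (m, (a, true))) : ℤ) - N (Sum.inr (m, (a, false)))))) := by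
    intro m a
    cases P m (π a) <;> simp <;> ring
  have hsum : (2 * (∑ m : Fin r, ∑ a : Fin 4, N (Sum.inr (m, (a, P m (π a))))) : ℤ) =
      (∑ m : Fin r, ∑ a : Fin 4, (((N (Sum.inr (m, (a, true))) : ℤ) + N (Sum.inr (m, (a, false)))))) +
        ∑ m : Fin r, ∑ a : Fin 4,
          (if P m (π a) then ((N (Sum.inr (m, (a, true))) : ℤ) - N (Sum.inr (m, (a, false))))
            else -(((N (Sum.inr (m, (a, true))) : ℤ) - N (Sum.inr (m, (a, false)))))) := by
    push_cast
    rw [Finset.mul_sum, ← Finset.sum_add_distrib]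
    refine Finset.sum_congr rfl fun m _ => ?_
    rw [Finset.mul_sum, ← Finset.sum_add_distrib]
    refine Finset.sum_congr rfl fun a _ => ?_
    exact key m a
  constructor
  · intro h
    have hz : (2 : ℤ) * ((N (Sum.inl true) : ℤ) + ((∑ m : Fin r, ∑ a : Fin 4, N (Sum.inr (m, (a, P m (π a)))) : ℕ) : ℤ)) =
        (N (Sum.inl true) : ℤ) + N (Sum.inl false) +
          ((∑ m : Fin r, ∑ a : Fin 4, (N (Sum.inr (m, (a, true))) + N (Sum.inr (m, (a, false)))) : ℕ) : ℤ) := by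
      exact_mod_cast h
    push_cast at hz hsum
    linarith
  · intro h
    have hz : (2 : ℤ) * ((N (Sum.inl true) : ℤ) + ((∑ m : Fin r, ∑ a : Fin 4, N (Sum.inr (m, (a, P m (π a)))) : ℕ) : ℤ)) =
        (N (Sum.inl true) : ℤ) + N (Sum.inl false) +
          ((∑ m : Fin r, ∑ a : Fin 4, (N (Sum.inr (m, (a, true))) + N (Sum.inr (m, (a, false)))) : ℕ) : ℤ) := by
      push_cast at hsum ⊢
      linarith
    exact_mod_cast hz

variable {π} (R)

/-- **The defect of a configuration balanced under `R`, at `π ∈ R`** (the signed equation for the fibre counts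
`N y = #{x ∈ T | v x = y}`). [cite: GaoUllmo2025, Thm 3.1] -/
theorem signed_of_modelBalancedO {T : Finset α} (hT : ModelBalancedO P R v T) {π : Equiv.Perm (Fin 4)} (hπ : π ∈ R) :
    (((T.filter fun x => v x = Sum.inl true).card : ℤ) - (T.filter fun x => v x = Sum.inl false).card) +
      ∑ m : Fin r, ∑ a : Fin 4, (if P m (π a) then
        (((T.filter fun x => v x = Sum.inr (m, (a, true))).card : ℤ) - (T.filter fun x => v x = Sum.inr (m, (a, false))).card)
        else -((((T.filter fun x => v x = Sum.inr (m, (a, true))).card : ℤ) -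
          (T.filter fun x => v x = Sum.inr (m, (a, false))).card))) = 0 := by
  rw [← balancedO_iff_signed P π fun y => (T.filter fun x => v x = y).card, ← card_filter_mem_eq_sumO, ← card_eq_sumO v T]
  exact hT π hπ

/-- **Conversely: a configuration whose fibre counts satisfy the signed equation at `π` is balanced at `π`.** [folklore] -/
theorem balancedO_of_signed {T : Finset α} {π : Equiv.Perm (Fin 4)}
    (h : (((T.filter fun x => v x = Sum.inl true).card : ℤ) - (T.filter fun x => v x = Sum.inl false).card) +
      ∑ m : Fin r, ∑ a : Fin 4, (if P m (π a) then
        (((T.filter fun x => v x = Sum.inr (m, (a, true))).card : ℤ) - (T.filter fun x => v x = Sum.inr (m, (a, false))).card)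
        else -((((T.filter fun x => v x = Sum.inr (m, (a, true))).card : ℤ) -
          (T.filter fun x => v x = Sum.inr (m, (a, false))).card))) = 0) :
    2 * (T.filter fun x => v x ∈ phiO P π).card = T.card := by
  rw [card_filter_mem_eq_sumO, card_eq_sumO v T, balancedO_iff_signed]
  exact h

end Summit.HodgeConjecture.CorCM.Census.OcticWeilMulti
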